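import Mathlib

/-!
# Colour-cell universality: the blow-up `𝔖ₘ →* 𝔖ₘₛ` (registered stub `colourSeparated_blowup`)

Crux `LevelGradedCohnUmans.GradedDesignFamily` (stmt-MatrixMultiplication-7610), tool for line
`schur-weyl-colour-cells` (architecture note §2(c), "colour-cell universality").

For `r ≤ 2^s` the `r`-colour cell of `𝔖ₘ`,
`J_r(m) = span{ g ↦ [c' ∘ g = c] : c c' : Fin m → Fin r }`,
embeds in the two-colour cell `J_2(ms)` of `𝔖ₘₛ` along the **blow-up** homomorphism
`ι : 𝔖ₘ →* 𝔖ₘₛ`, which lets `g` act on `Fin m × Fin s ≃ Fin (m·s)` by `(i, j) ↦ (g i, j)`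
(every point is replaced by a block of `s` points, permuted rigidly).  Encoding a colour `a : Fin r`
by a binary word `enc a : Fin s → Fin 2` (`enc` injective, possible as `r ≤ 2^s`) turns an
`r`-colouring `c` of `Fin m` into a `2`-colouring `C (i, j) = enc (c i) j` of `Fin (m·s)`, and
`C' ∘ ι g = C ↔ c' ∘ g = c`.  Hence every colouring-incidence test of `𝔖ₘ` is the restriction
along `ι` of a two-colouring-incidence test of `𝔖ₘₛ`, so every `f ∈ J_r(m)` is `F ∘ ι` for some
`F ∈ J_2(ms)`; since `ι` is an injective homomorphism, a `J_r(m)`-separated triple `(X, Y, Z)` is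
carried to the `J_2(ms)`-separated triple `(ι X, ι Y, ι Z)` (same cardinalities).

Contents: `colourBlowup_exists_hom` (the hom and its defining formula), `colourBlowup_injective`,
`colourBlowup_encode` (the encoding), `colourBlowup_span_transport` (lifting `J_r(m)` through
`J_2(ms)`), and the registered stub `colourSeparated_blowup` verbatim.  Elementary; no named facts.
-/

open scoped BigOperators

-- the tree's namespace for this crux's theorem files repeats the summit name (summit = problem)
set_option linter.dupNamespace false

namespace Summit.MatrixMultiplication.MatrixMultiplication.Theorems.GradedDesignFamily

open Equiv

/-- The blow-up homomorphism `𝔖ₘ →* 𝔖ₘₛ`: there is a group homomorphism `ι` with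
`ι g (⟨i, j⟩) = ⟨g i, j⟩` in the coordinates `finProdFinEquiv : Fin m × Fin s ≃ Fin (m * s)`.
[folklore] -/
theorem colourBlowup_exists_hom (m s : ℕ) :
    ∃ ι : Perm (Fin m) →* Perm (Fin (m * s)),
      ∀ (g : Perm (Fin m)) (i : Fin m) (j : Fin s),
        ι g (finProdFinEquiv (i, j)) = finProdFinEquiv (g i, j) := by
  let κ : Perm (Fin m) →* Perm (Fin m × Fin s) :=
    MonoidHom.mk' (fun g : Perm (Fin m) => Equiv.prodCongr g (Equiv.refl (Fin s)))
      (fun g h => by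
        ext ⟨i, j⟩ <;> simp [Equiv.Perm.mul_apply])
  refine ⟨(Equiv.permCongrHom (finProdFinEquiv : Fin m × Fin s ≃ Fin (m * s))).toMonoidHom.comp κ,
    fun g i j => ?_⟩
  simp [κ, Equiv.permCongrHom, Equiv.permCongr_apply]

/-- The blow-up is injective as soon as `s ≥ 1` (look at the copy `j = 0`). [folklore] -/
theorem colourBlowup_injective {m s : ℕ} (hs : 1 ≤ s) (ι : Perm (Fin m) →* Perm (Fin (m * s)))
    (hι : ∀ (g : Perm (Fin m)) (i : Fin m) (j : Fin s),
      ι g (finProdFinEquiv (i, j)) = finProdFinEquiv (g i, j)) :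
    Function.Injective ι := by
  intro g h hgh
  refine Equiv.ext fun i => ?_
  have j : Fin s := ⟨0, hs⟩
  have h1 := hι g i j
  rw [hgh, hι h i j] at h1
  have h2 := finProdFinEquiv.injective h1
  exact ((Prod.ext_iff.1 h2).1).symm

/-- Binary encoding of colours: for `r ≤ 2^s`, every pair of `r`-colourings `c, c'` of `Fin m` is
realised by a pair of `2`-colourings `C, C'` of `Fin (m * s)` with `C' ∘ ι g = C ↔ c' ∘ g = c` for
all `g ∈ 𝔖ₘ` (`C ⟨i, j⟩ = j`-th bit of an injective code word for `c i`). [folklore] -/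
theorem colourBlowup_encode {m s r : ℕ} (hr : r ≤ 2 ^ s) (ι : Perm (Fin m) →* Perm (Fin (m * s)))
    (hι : ∀ (g : Perm (Fin m)) (i : Fin m) (j : Fin s),
      ι g (finProdFinEquiv (i, j)) = finProdFinEquiv (g i, j))
    (c c' : Fin m → Fin r) :
    ∃ C C' : Fin (m * s) → Fin 2, ∀ g : Perm (Fin m), (C' ∘ ⇑(ι g) = C ↔ c' ∘ ⇑g = c) := by
  have hcard : Fintype.card (Fin r) ≤ Fintype.card (Fin s → Fin 2) := by
    simpa using hr
  obtain ⟨enc⟩ := Function.Embedding.nonempty_of_card_le hcard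
  refine ⟨fun p => enc (c (finProdFinEquiv.symm p).1) (finProdFinEquiv.symm p).2,
    fun p => enc (c' (finProdFinEquiv.symm p).1) (finProdFinEquiv.symm p).2, fun g => ?_⟩
  constructor
  · intro hC
    funext i
    simp only [Function.comp_apply]
    apply enc.injective
    funext j
    have := congrFun hC (finProdFinEquiv (i, j))
    simp only [Function.comp_apply] at this
    rw [hι] at this
    simpa only [Equiv.symm_apply_apply] using this
  · intro hc
    funext p
    obtain ⟨⟨i, j⟩, rfl⟩ := finProdFinEquiv.surjective p
    have hci : c' (g i) = c i := by
      have := congrFun hc i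
      simpa only [Function.comp_apply] using this
    simp only [Function.comp_apply]
    rw [hι]
    simp only [Equiv.symm_apply_apply]
    rw [hci]

/-- Transport of the colour cell: along a homomorphism `ι : 𝔖ₘ →* 𝔖ₙ` under which every
`r`-colouring-incidence test of `𝔖ₘ` is the pull-back of a `2`-colouring-incidence test of `𝔖ₙ`,
every `f ∈ J_r(m)` is `F ∘ ι` for some `F ∈ J_2(n)` (linear algebra: `span` commutes with the
pull-back map). [folklore] -/
theorem colourBlowup_span_transport {m n r : ℕ} (ι : Perm (Fin m) →* Perm (Fin n))
    (henc : ∀ c c' : Fin m → Fin r, ∃ C C' : Fin n → Fin 2,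
      ∀ g : Perm (Fin m), (C' ∘ ⇑(ι g) = C ↔ c' ∘ ⇑g = c))
    (f : Perm (Fin m) → ℂ)
    (hf : f ∈ Submodule.span ℂ {f : Perm (Fin m) → ℂ |
      ∃ c c' : Fin m → Fin r, f = fun g : Perm (Fin m) => if c' ∘ (⇑g) = c then (1 : ℂ) else 0}) :
    ∃ F ∈ Submodule.span ℂ {f : Perm (Fin n) → ℂ |
        ∃ c c' : Fin n → Fin 2, f = fun g : Perm (Fin n) => if c' ∘ (⇑g) = c then (1 : ℂ) else 0},
      ∀ g : Perm (Fin m), F (ι g) = f g := by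
  set S₂ : Set (Perm (Fin n) → ℂ) := {f : Perm (Fin n) → ℂ |
      ∃ c c' : Fin n → Fin 2, f = fun g : Perm (Fin n) => if c' ∘ (⇑g) = c then (1 : ℂ) else 0}
    with hS₂
  set Φ : (Perm (Fin n) → ℂ) →ₗ[ℂ] (Perm (Fin m) → ℂ) := LinearMap.funLeft ℂ ℂ (⇑ι) with hΦ
  have hle : Submodule.span ℂ {f : Perm (Fin m) → ℂ |
      ∃ c c' : Fin m → Fin r, f = fun g : Perm (Fin m) => if c' ∘ (⇑g) = c then (1 : ℂ) else 0} ≤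
      (Submodule.span ℂ S₂).map Φ := by
    rw [Submodule.span_le]
    rintro _ ⟨c, c', rfl⟩
    obtain ⟨C, C', hCC'⟩ := henc c c'
    refine ⟨fun g : Perm (Fin n) => if C' ∘ (⇑g) = C then (1 : ℂ) else 0,
      Submodule.subset_span ⟨C, C', rfl⟩, ?_⟩
    funext g
    simp only [hΦ, LinearMap.funLeft_apply]
    by_cases h : c' ∘ ⇑g = c
    · rw [if_pos h, if_pos ((hCC' g).2 h)]
    · rw [if_neg h, if_neg (fun h' => h ((hCC' g).1 h'))]
  obtain ⟨F, hF, hFf⟩ := Submodule.mem_map.1 (hle hf)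
  refine ⟨F, hF, fun g => ?_⟩
  have := congrFun hFf g
  simpa [hΦ, LinearMap.funLeft_apply] using this

/-- **Colour-cell universality (registered stub `colourSeparated_blowup`).**  For `1 ≤ s` and
`r ≤ 2^s` the blow-up `ι : 𝔖ₘ →* 𝔖ₘₛ` is injective and carries every `J_r(m)`-separated triple
`(X, Y, Z)` of `𝔖ₘ` (separation clause of `GradedDesignFamily` at the `r`-colour cell) to the
`J_2(ms)`-separated triple `(ι X, ι Y, ι Z)` of `𝔖ₘₛ`: the separator of the target `(ι x₀, ι z₀)` is
the lift `F ∈ J_2(ms)` of the separator `f ∈ J_r(m)` of `(x₀, z₀)`, `F ∘ ι = f`. [folklore] -/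
theorem colourSeparated_blowup (m s r : ℕ) (hs : 1 ≤ s) (hr : r ≤ 2 ^ s) (X Y Z : Finset (Equiv.Perm (Fin m))) (hsep : ∀ x₀ ∈ X, ∀ z₀ ∈ Z, ∃ f ∈ Submodule.span ℂ {f : Equiv.Perm (Fin m) → ℂ | ∃ c c' : Fin m → Fin r, f = fun g : Equiv.Perm (Fin m) => if c' ∘ (⇑g) = c then (1 : ℂ) else 0}, ∀ x ∈ X, ∀ y ∈ Y, ∀ y' ∈ Y, ∀ z ∈ Z, (x = x₀ ∧ y = y' ∧ z = z₀ → f (x⁻¹ * y * y'⁻¹ * z) = 1) ∧ (¬ (x = x₀ ∧ y = y' ∧ z = z₀) → f (x⁻¹ * y * y'⁻¹ * z) = 0)) : ∃ ι : Equiv.Perm (Fin m) →* Equiv.Perm (Fin (m * s)), Function.Injective ι ∧ ∀ x₀ ∈ X.image ι, ∀ z₀ ∈ Z.image ι, ∃ f ∈ Submodule.span ℂ {f : Equiv.Perm (Fin (m * s)) → ℂ | ∃ c c' : Fin (m * s) → Fin 2, f = fun g : Equiv.Perm (Fin (m * s)) => if c' ∘ (⇑g) = c then (1 : ℂ) else 0},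 ∀ x ∈ X.image ι, ∀ y ∈ Y.image ι, ∀ y' ∈ Y.image ι, ∀ z ∈ Z.image ι, (x = x₀ ∧ y = y' ∧ z = z₀ → f (x⁻¹ * y * y'⁻¹ * z) = 1) ∧ (¬ (x = x₀ ∧ y = y' ∧ z = z₀) → f (x⁻¹ * y * y'⁻¹ * z) = 0) := by
  obtain ⟨ι, hι⟩ := colourBlowup_exists_hom m s
  have hinj : Function.Injective ι := colourBlowup_injective hs ι hι
  refine ⟨ι, hinj, ?_⟩
  intro x₀' hx₀' z₀' hz₀'
  obtain ⟨x₀, hx₀, rfl⟩ := Finset.mem_image.1 hx₀'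
  obtain ⟨z₀, hz₀, rfl⟩ := Finset.mem_image.1 hz₀'
  obtain ⟨f, hf, hprop⟩ := hsep x₀ hx₀ z₀ hz₀
  obtain ⟨F, hF, hFf⟩ :=
    colourBlowup_span_transport ι (fun c c' => colourBlowup_encode hr ι hι c c') f hf
  refine ⟨F, hF, ?_⟩
  intro x' hx' y₁' hy₁' y₂' hy₂' z' hz'
  obtain ⟨x, hx, rfl⟩ := Finset.mem_image.1 hx'
  obtain ⟨y, hy, rfl⟩ := Finset.mem_image.1 hy₁'
  obtain ⟨y', hy', rfl⟩ := Finset.mem_image.1 hy₂'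
  obtain ⟨z, hz, rfl⟩ := Finset.mem_image.1 hz'
  have hrw : (ι x)⁻¹ * ι y * (ι y')⁻¹ * ι z = ι (x⁻¹ * y * y'⁻¹ * z) := by
    simp only [map_mul, map_inv]
  rw [hrw, hFf, hinj.eq_iff, hinj.eq_iff, hinj.eq_iff]
  exact hprop x hx y hy y' hy' z hz

end Summit.MatrixMultiplication.MatrixMultiplication.Theorems.GradedDesignFamily
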